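import Mathlib
import Summits.NavierStokesRegularity.NavierStokesRegularity.Theorems.L3TimeExponentPincerRingPersistenceData
import HarnessLib.Audit
import HarnessLib

/-!
# L3TimeExponentPincer — the explicit ring datum family, packaged once (Tao class exposed)

Support kernel for the crux `L3CascadeJaw` (item stmt-NavierStokesRegularity-19499); sequel of
`…RingPersistenceData`.  The assembly of the explicit glued-dipole datum (`…RingDatumBounds`,
`…RingDatumEnergy`, `…RingPersistenceData`) is packaged here ONCE as an existential statement, so
that every later consumer instantiates it instead of repeating the assembly:

* `exists_ringData` — absolute `c ∈ (0,1]`, `C₀ > 0` and, for every `ℓ ∈ (0,1]`, a smooth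
  divergence-free rapidly decaying axisymmetric swirl-free datum with the seventeen datum bounds of
  `lpPersistence_of_ringData`, the three scale inequalities, and `‖u₀‖₃ ≤ C₀ ℓ^{-1/2}`;
* `taoRingFamily` — the same family AS SOLUTIONS with the Tao class exposed: for every
  `ℓ ∈ (0,1]` a datum `u₀` (axisymmetric, swirl-free, `‖u₀‖₃ ≤ C₀ℓ^{-1/2}`) and a Tao-class solution
  `IsTaoSolutionOn 1 1 u₀ u p` (hence a frame solution, `IsFrameSolution 1 1 u p`) with
  `energy0 u ≤ 1` and the floor `‖u(t)‖₃ ≥ c ℓ^{-1/2}` on `(0, cℓ²)` — the input of the swirl-free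
  calibrations (`CritSmoothingNoSwirl`, `…CritModulusNoSwirlLinearLower`).

WHAT THIS IS NOT: not NS regularity or blow-up; explicit smooth global swirl-free solutions
(Ladyzhenskaya / Ukhovskii–Yudovich via `exists_isTaoSolutionOn_of_noSwirl`); no crux claim.
-/

namespace Summit.NavierStokesRegularity.NavierStokesRegularity.Theorems.L3TimeExponentPincerRingFamily

open Real Set Metric MeasureTheory Literature.Analysis.FluidPDE Literature.Analysis.Calculus
open Summit.NavierStokesRegularity.NavierStokesRegularity.Theorems.L3TimeExponentPincerQuantJaw
open Summit.NavierStokesRegularity.NavierStokesRegularity.Theorems.L3TimeExponentPincerRingPersistenceFloor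
open Summit.NavierStokesRegularity.NavierStokesRegularity.Theorems.L3TimeExponentPincerRingPersistenceHolds
open Summit.NavierStokesRegularity.NavierStokesRegularity.Theorems.L3TimeExponentPincerRingPersistenceData
open Summit.NavierStokesRegularity.NavierStokesRegularity.Theorems.L3TimeExponentPincerRingDatumBounds
open Summit.NavierStokesRegularity.NavierStokesRegularity.Theorems.L3TimeExponentPincerRingDatumEnergy
open Summit.NavierStokesRegularity.NavierStokesRegularity.Theorems.L3TimeExponentPincerRingDatumDecayIntegral
open scoped ENNReal ContDiff Topology

/-- **The explicit ring datum family** (with `L³` control): the full datum-side interface of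
`lpPersistence_of_ringData` / `l3PersistenceWithData_of_ringData`, witnessed. -/
theorem exists_ringData :
    ∃ c C₀ : ℝ, 0 < c ∧ c ≤ 1 ∧ 0 < C₀ ∧ ∀ ℓ : ℝ, 0 < ℓ → ℓ ≤ 1 →
      ∃ (u₀ : EuclideanSpace ℝ (Fin 3) → EuclideanSpace ℝ (Fin 3)) (M m mneg P E : ℝ),
        ContDiff ℝ (⊤ : ℕ∞) u₀ ∧ VectorCalculus.IsDivFree u₀ ∧ HasRapidSpatialDecay u₀ ∧
        IsAxisymmetric u₀ ∧ HasNoSwirl u₀ ∧ Integrable (angVortQuot u₀) ∧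
        (∫⁻ x, ‖u₀ x‖ₑ ^ 2 ≤ 1) ∧
        (∀ x, |angVortQuot u₀ x| ≤ M) ∧ (∫ x, |angVortQuot u₀ x| ≤ m) ∧ 0 < m ∧
        (∫⁻ x, ENNReal.ofReal ((angVortQuot u₀ x)⁻) ≤ ENNReal.ofReal mneg) ∧ 0 ≤ mneg ∧ 0 < P ∧
        (∫⁻ x, ENNReal.ofReal (cylRadius x ^ 2 * (angVortQuot u₀ x)⁺) ≤ ENNReal.ofReal P) ∧
        (∫⁻ x, ENNReal.ofReal (cylRadius x ^ 2 * (angVortQuot u₀ x)⁻) ≤ ENNReal.ofReal P) ∧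
        0 < E ∧ (ENNReal.ofReal E ≤ ∫⁻ x, ‖u₀ x‖ₑ ^ 2) ∧
        2 * (c * ℓ ^ (2 : ℝ)) * (6 * Real.sqrt (M * Real.sqrt m) * Real.sqrt mneg) ≤
          Real.sqrt (Real.sqrt (2 * P)) / 2 ∧
        16 * M * P * (c * ℓ ^ (2 : ℝ)) ≤ E ∧
        c * ℓ ^ (-(1 / 2 : ℝ)) ≤
          (π * (E / 2) ^ 3 / (512 * (Real.sqrt m * Real.sqrt (4 * P)) ^ 3)) ^ (1 / 3 : ℝ) ∧
        eLpNorm u₀ 3 volume ≤ ENNReal.ofReal (C₀ * ℓ ^ (-(1 / 2 : ℝ))) := by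
  -- the absolute letters `Φ`, `V`, `I₆` and constants `c_E`, `c`, `C₀`
  obtain ⟨Φ₀, -, hΦ₀⟩ := exists_bound_deriv_smoothTransition
  obtain ⟨Φ, hΦ1, hΦ⟩ : ∃ Φ : ℝ, 1 ≤ Φ ∧ ∀ τ, |deriv Real.smoothTransition τ| ≤ Φ :=
    ⟨max Φ₀ 1, le_max_right _ _, fun τ => (hΦ₀ τ).trans (le_max_left _ _)⟩
  have hΦ0 : 0 < Φ := by linarith
  obtain ⟨V, hVdef⟩ : ∃ V : ℝ, V = (volume (ball (0 : EuclideanSpace ℝ (Fin 3)) 1)).toReal := ⟨_, rfl⟩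
  have hV : 0 < V := by
    rw [hVdef]
    exact ENNReal.toReal_pos (measure_ball_pos volume _ one_pos).ne' measure_ball_lt_top.ne
  set I : ℝ≥0∞ := ∫⁻ y : EuclideanSpace ℝ (Fin 3), ENNReal.ofReal ((1 + ‖y‖) ^ (-(6 : ℝ))) with hIdef
  have hI : I ≠ ⊤ := lintegral_one_add_norm_rpow_neg_six_lt_top.ne
  obtain ⟨i, hidef⟩ : ∃ i : ℝ, i = I.toReal := ⟨_, rfl⟩
  have hi : 0 ≤ i := by rw [hidef]; exact ENNReal.toReal_nonneg
  have hIi : I = ENNReal.ofReal i := by rw [hidef, ENNReal.ofReal_toReal hI]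
  obtain ⟨cE, hcEdef⟩ : ∃ cE : ℝ, cE = 1 / (1 + 6656 * i) := ⟨_, rfl⟩
  have hcE : 0 < cE := by rw [hcEdef]; positivity
  have hcE1 : cE ≤ 1 := by
    rw [hcEdef, div_le_one (by positivity)]; linarith
  obtain ⟨c, hcdef⟩ : ∃ c : ℝ, c = cE / (2 ^ 31 * Φ ^ 4 * (1 + V) ^ 2) := ⟨_, rfl⟩
  obtain ⟨hc0, hc1, -, -, -⟩ := const_bounds hcE hcE1 hΦ1 hV hcdef
  refine ⟨c, (4 * cE) ^ (1 / 3 : ℝ), hc0, hc1, by positivity, fun ℓ hℓ hℓ1 => ?_⟩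
  -- `ℓ = t²`, `0 < t ≤ 1`
  obtain ⟨t, ht, ht1, rfl⟩ : ∃ t : ℝ, 0 < t ∧ t ≤ 1 ∧ ℓ = t ^ 2 :=
    ⟨Real.sqrt ℓ, Real.sqrt_pos.2 hℓ, by simpa using Real.sqrt_le_sqrt hℓ1, (Real.sq_sqrt hℓ.le).symm⟩
  have ht0 : t ≠ 0 := ht.ne'
  have hℓ2 : (t ^ 2) ^ (2 : ℝ) = t ^ 4 := by rw [Real.rpow_two]; ring
  have hℓh : (t ^ 2) ^ (-(1 / 2 : ℝ)) = t⁻¹ := by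
    rw [Real.rpow_neg (sq_nonneg t), ← Real.sqrt_eq_rpow, Real.sqrt_sq ht.le]
  -- strength, shape, potential
  obtain ⟨κ, hκ⟩ : ∃ κ : ℝ, κ = cE * t ^ 3 := ⟨_, rfl⟩
  have hκ0 : 0 < κ := by rw [hκ]; positivity
  obtain ⟨G, hG⟩ : ∃ G : ℝ → ℝ, G = fun s => -κ * (Real.smoothTransition (s / t ^ 4 - 1) -
      Real.smoothTransition (s / 16 - 1)) := ⟨_, rfl⟩
  obtain ⟨F, hF⟩ : ∃ F : ℝ → ℝ, F = fun s => ∫ τ in (32 : ℝ)..s, τ ^ (-(5 / 2 : ℝ)) * G τ := ⟨_, rfl⟩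
  obtain ⟨hsm, hdiv, hdec, hax, hsw⟩ := ringDatum_frame hG hF ht ht1
  have hM := ringDatum_abs_eta_le hG hF ht ht1 hκ0.le hΦ
  have ht4 : t ^ 4 ≤ 1 := pow_le_one₀ ht.le ht1
  -- energy `≤ 1`
  have hE1 : ∫⁻ x, ‖curl (fun y : EuclideanSpace ℝ (Fin 3) => F (‖y‖ ^ 2) • rotGen y) x‖ₑ ^ 2 ≤ 1 := by
    refine (ringDatum_energy_le hG hF ht ht1 hκ0.le).trans ?_
    rw [← hIdef, hIi, ← ENNReal.ofReal_mul (by positivity), ← ENNReal.ofReal_one]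
    refine ENNReal.ofReal_le_ofReal ?_
    have e : 6656 / 9 * κ ^ 2 / t ^ 6 * i = 6656 / 9 * cE ^ 2 * i := by
      rw [hκ]; field_simp; try ring
    rw [e]
    exact energy_const_le_one hi hcEdef
  refine ⟨curl fun y : EuclideanSpace ℝ (Fin 3) => F (‖y‖ ^ 2) • rotGen y, 4 * Φ * κ / t ^ 10,
    128 * Φ * κ * V / t ^ 4, Φ * κ * V, 128 * Φ * κ * V, κ ^ 2 * V / (144000 * t ^ 6),
    hsm, hdiv, hdec, hax, hsw, ringDatum_integrable hG hF ht ht1, hE1, hM, ?_, by positivity, ?_,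
    by positivity, by positivity, ?_, ?_, by positivity, ?_, ?_, ?_, ?_, ?_⟩
  · -- mass `m`
    refine (ringDatum_mass_le hG hF ht ht1 hκ0.le hΦ).trans ?_
    rw [← hVdef]
    have h96 : Φ * κ * V ≤ 96 * Φ * κ * V / t ^ 4 := by
      rw [le_div_iff₀ (by positivity)]
      nlinarith [mul_pos (mul_pos hΦ0 hκ0) hV]
    have e : 128 * Φ * κ * V / t ^ 4 = 32 * Φ * κ * V / t ^ 4 + 96 * Φ * κ * V / t ^ 4 := by ring
    rw [e]
    linarith
  · rw [hVdef]; exact ringDatum_negPart_le hG hF ht ht1 hκ0.le hΦ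
  · rw [hVdef]; exact ringDatum_rsq_posPart_le hG hF ht ht1 hκ0.le hΦ
  · rw [hVdef]; exact ringDatum_rsq_negPart_le hG hF ht ht1 hκ0.le hΦ
  · rw [hVdef]; exact ringDatum_energy_ge hG hF ht ht1 hκ0.le
  · rw [hℓ2]; exact scale_window ht ht1 hcE hcE1 hΦ1 hV hcdef hκ
  · rw [hℓ2]; exact scale_energy ht hcE hcE1 hΦ1 hV hcdef
  · rw [hℓh]; exact scale_floor ht hcE hcE1 hΦ1 hV hcdef hκ
  · -- the datum clause `‖u₀‖₃ ≤ (4c_E)^{1/3} t⁻¹ = (4κ/t⁶)^{1/3}`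
    refine (ringDatum_eLpNorm_three_le hG hF ht ht1 hκ0.le hE1).trans (le_of_eq ?_)
    rw [hℓh]
    congr 1
    have e1 : 4 * κ / t ^ 6 = 4 * cE / t ^ 3 := by rw [hκ]; field_simp; try ring
    have e2 : (t ^ 3) ^ (1 / 3 : ℝ) = t := by
      rw [← Real.rpow_natCast, ← Real.rpow_mul ht.le]; norm_num
    rw [e1, Real.div_rpow (by positivity) (by positivity), e2]
    try rw [div_eq_mul_inv]

/-- **The ring family as Tao-class solutions.**  For every `ℓ ∈ (0, 1]`: an axisymmetric swirl-free
datum `u₀` with `‖u₀‖₃ ≤ C₀ ℓ^{-1/2}`, a Tao-class solution `(u, p)` on `[0, 1]` (`ν = 1`) from `u₀`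
which is a frame solution with `energy0 u ≤ 1`, and the floor `‖u(t)‖₃ ≥ c ℓ^{-1/2}` for
`t ∈ (0, c ℓ²)`. -/
theorem taoRingFamily :
    ∃ c C₀ : ℝ, 0 < c ∧ c ≤ 1 ∧ 0 < C₀ ∧ ∀ ℓ : ℝ, 0 < ℓ → ℓ ≤ 1 →
      ∃ (u₀ : EuclideanSpace ℝ (Fin 3) → EuclideanSpace ℝ (Fin 3))
        (u : ℝ → EuclideanSpace ℝ (Fin 3) → EuclideanSpace ℝ (Fin 3))
        (p : ℝ → EuclideanSpace ℝ (Fin 3) → ℝ),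
        IsTaoSolutionOn 1 1 u₀ u p ∧ IsAxisymmetric u₀ ∧ HasNoSwirl u₀ ∧
        IsFrameSolution 1 1 u p ∧ energy0 u ≤ 1 ∧
        eLpNorm u₀ 3 volume ≤ ENNReal.ofReal (C₀ * ℓ ^ (-(1 / 2 : ℝ))) ∧
        ∀ t ∈ Ioo 0 (c * ℓ ^ (2 : ℝ)),
          ENNReal.ofReal (c * ℓ ^ (-(1 / 2 : ℝ))) ≤ eLpNorm (u t) 3 volume := by
  obtain ⟨c, C₀, hc, hc1, hC₀, hdata⟩ := exists_ringData
  refine ⟨c, C₀, hc, hc1, hC₀, fun ℓ hℓ hℓ1 => ?_⟩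
  obtain ⟨u₀, M, m, mneg, P, E, hsm, hdiv, hdec, hax, hsw, hL1, hE1, hM, hm, hm0, hmneg, hmneg0,
    hP, hPp, hPn, hE, hEu, hW1, hW2, hF, hL3⟩ := hdata ℓ hℓ hℓ1
  obtain ⟨u, p, hsol⟩ := exists_isTaoSolutionOn_of_noSwirl tao2011_smooth_local_existence_holds
    axisymmetricNoSwirl_enstrophy_apriori_holds one_pos hsm hdiv
    (fun n => hdec.lintegral_enorm_iteratedFDeriv_sq_lt_top (μ := volume) n) hax hsw one_pos
  refine ⟨u₀, u, p, hsol, hax, hsw, ⟨?_, ?_, ?_⟩, ?_, hL3, ?_⟩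
  · exact hsol.classical.mono Ico_subset_Icc_self (uniqueDiffOn_Ico 0 1)
  · have := hsol.isLerayHopfOn one_pos
    rwa [← hsol.initial] at this
  · rw [hsol.initial]; exact hdec
  · show ∫⁻ x, ‖u 0 x‖ₑ ^ 2 ≤ 1
    rw [hsol.initial]; exact hE1
  · intro t ht
    have hℓ2 : 0 < ℓ ^ (2 : ℝ) := Real.rpow_pos_of_pos hℓ _
    have hτpos : 0 < c * ℓ ^ (2 : ℝ) := mul_pos hc hℓ2
    have hτ1 : c * ℓ ^ (2 : ℝ) ≤ 1 := by
      calc c * ℓ ^ (2 : ℝ) ≤ 1 * 1 :=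
            mul_le_mul hc1 (Real.rpow_le_one hℓ.le hℓ1 (by norm_num)) hℓ2.le zero_le_one
        _ = 1 := one_mul _
    have hτ : c * ℓ ^ (2 : ℝ) ∈ Ioc (0 : ℝ) 1 := ⟨hτpos, hτ1⟩
    have htI : t ∈ Icc 0 (c * ℓ ^ (2 : ℝ)) := ⟨ht.1.le, ht.2.le⟩
    have hM0 : 0 ≤ M := (abs_nonneg _).trans (hM 0)
    have htE : 16 * (1 : ℝ) * M * P * t ≤ E := by
      have : 16 * M * P * t ≤ 16 * M * P * (c * ℓ ^ (2 : ℝ)) :=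
        mul_le_mul_of_nonneg_left ht.2.le (by positivity)
      linarith
    have hfl := l3_floor hsol one_pos one_pos hax hsw hL1 hM hm0 hm hmneg hmneg0 hP hPp hPn hτ hW1
      hE hEu htI htE
    exact (ENNReal.ofReal_le_ofReal hF).trans hfl

end Summit.NavierStokesRegularity.NavierStokesRegularity.Theorems.L3TimeExponentPincerRingFamily
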